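import Literature.MathematicalPhysics.QuantumManyBody.PeriodicBoseGasFourier
import Mathlib.Analysis.SpecialFunctions.Complex.Log
import Mathlib.Analysis.Calculus.FDeriv.Equiv
import Mathlib.Analysis.Calculus.Deriv.Comp
import Mathlib.Analysis.Calculus.Deriv.Mul
import Mathlib.Algebra.Order.Chebyshev
import Mathlib.MeasureTheory.Measure.OpenPos
import HarnessLib

/-!
# Total-momentum (Bloch) sectors of the periodic Bose gas and their energy infima

Topic `Literature/MathematicalPhysics/QuantumManyBody` (definition item `defn-momentumSectorEnergy`,
wanted by route `BECSectorGap`, items stmt-AtomisticToContinuum-5149/5150/5151/5152, which inline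
the infimum below verbatim). Companion of `PeriodicBoseGas.lean` (`PeriodicTrialState`,
`periodicEnergy`, `periodicGroundStateEnergy`) and `PeriodicBoseGasFourier.lean` (`cellWave`).

On the torus `(ℝ³/Lℤ³)` the `M`-body Hamiltonian `H = ∑ⱼ -Δⱼ + ∑_{i<j} v^per(xᵢ - xⱼ)` commutes
with the total momentum `P = ∑ⱼ -i∇ⱼ`, whose joint spectrum is the dual lattice `(2π/L)ℤ³`;
`H(k)` is the restriction of `H` to the subspace `P = k` and the *infimum of the energy–momentum
spectrum in the box* is `inf sp H(k) = E^{L,M} + ε^{L,M}(k)`, `ε^{L,M}(k) = inf sp(H(k) - E^{L,M})`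
the infimum of the excitation spectrum (IES) [CorneanDerezinskiZin2009, §1.1 (1.6)]. A wave
function lies in the sector `P = k` iff it transforms under the simultaneous translation of all
particles by the character `e^{ik·s}`:
`Ψ(x₁ + s, …, x_M + s) = e^{ik·s} Ψ(x₁, …, x_M)` for all `s ∈ ℝ³` (`HasTotalMomentum k Ψ`; for `C¹`
functions this is `PΨ = kΨ` pointwise, `HasTotalMomentum.sum_fderiv_apply_single`).

* `HasTotalMomentum k ψ` — the Bloch condition above, for `ψ : (ℝ³)^M → ℂ` and `k ∈ ℝ³`.
* `momentumSectorEnergy v M L k = ⨅ {⟨Ψ, HΨ⟩ : Ψ ∈ PeriodicTrialState M L, P Ψ = k Ψ}` — the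
  bottom of the periodic `M`-body energy (quadratic form `periodicEnergy`, units `ħ = 2m = 1`) in
  the sector of total momentum `k`, i.e. `inf sp H^{L,M}(k) = E^{L,M} + ε^{L,M}(k)` of
  [CorneanDerezinskiZin2009, §1.1 (1.6)] taken over the `C¹` form core; `⊤` when the sector is
  empty (`k ∉ (2π/L)ℤ³`, `momentumSectorEnergy_eq_top_of_forall_ne`) or `L ≤ 0 < M`
  (`momentumSectorEnergy_of_nonpos`). `momentumSectorEnergy_eq_iInf` records that it is
  *definitionally* the expression inlined in the route items (proof `rfl`).

API (all proved): the variational inequalities `periodicGroundStateEnergy ≤ momentumSectorEnergy`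
and `momentumSectorEnergy ≤ periodicEnergy Ψ` for `Ψ` in the sector; the sector is contained in
the dual lattice (`HasTotalMomentum.exists_eq_latticeVec`: translating every particle by `L eₐ` is
trivial by periodicity and multiplies by `e^{ik_aL}`); conversely every dual-lattice sector of
`M ≥ 1` particles is inhabited by the normalised symmetrised plane wave
`N_k 1 = ∑ⱼ e^{ik·xⱼ}` [CorneanDerezinskiZin2009, §2.7 (the operator `N_k`)]
(`PeriodicTrialState.planeWave`, `exists_hasTotalMomentum_iff`); complex conjugation maps the
sector `k` onto `-k` with the same energy (`momentumSectorEnergy_neg`); the momentum eigenvalue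
equation `∑ⱼ ∂_{j,a}Ψ = i kₐ Ψ` and the centre-of-mass bound `⟨Ψ,HΨ⟩ ≥ |k|²/M`
(`ofReal_norm_sq_div_le_momentumSectorEnergy`: `∑ⱼ|∇ⱼΨ|² ≥ |∑ⱼ∇ⱼΨ|²/M` by Cauchy–Schwarz; this is
`H ≥ P²/(2mM)` with `2m = 1`, the free part of the Galilei-invariant splitting
`H = P²/(2mM) + H_rel` behind [CorneanDerezinskiZin2009, §2.2 (2.3)]). A normalising constructor
`PeriodicTrialState.ofFun` and the positivity lemma `lintegral_cellN_pos` are included as tools.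

## Design choices

* The Bloch condition is stated for all `s ∈ ℝ³` (not only lattice translations): together with
  `Lℤ³`-periodicity in each particle it forces `k ∈ (2π/L)ℤ³` for a non-zero state, which is how
  the discreteness of the momentum spectrum appears here; for `M = 0` only `k = 0` is inhabited.
* `momentumSectorEnergy v M L 0 = periodicGroundStateEnergy v M L` is **not** asserted: `≥` is
  `periodicGroundStateEnergy_le_momentumSectorEnergy`, while `≤` says that the ground state may be
  chosen translation invariant, i.e. the Perron–Frobenius uniqueness/positivity of the torus
  ground state ("It is well known that the ground state of `H` is nondegenerate",
  [CorneanDerezinskiZin2009, §2.7]; `ε^{L,n}(0) = 0`, ibid. §1.1) — an operator-theoretic input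
  deliberately left to the routes (item `ZeroMomentumGround` of `BECSectorGap`).
* The Galilei boost `Ψ ↦ e^{2πi m·∑ⱼxⱼ/L}Ψ` (which maps the sector `k` to `k + 2πMm/L`,
  [CorneanDerezinskiZin2009, §2.2 (2.1)–(2.2)]) already exists in the tree as
  `PeriodicTrialState.boost` (file `Literature/Barriers/AtomisticToContinuum/
  KineticGapLengthScalesNarrow.lean`) and is not duplicated here.
* Everything is over `ℝ≥0∞` lower Lebesgue integrals on the fundamental cell, as in
  `PeriodicBoseGas.lean`; Mathlib has no many-body momentum operators (searched `momentum`,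
  `Bloch`, `totalMomentum`).

## References

* [CorneanDerezinskiZin2009] H. D. Cornean, J. Dereziński, P. Ziń, *On the infimum of the
  energy–momentum spectrum of a homogeneous Bose gas*, J. Math. Phys. 50 (2009) 062103,
  arXiv:math-ph/0511007: §1.1 (1.6) (`H^{L,n}(k)`, `ε^{L,n}(k)`, "infimum of the energy–momentum
  spectrum in the box"), §2.2 (Galilei covariance, `H - P²/2n`), §2.3 (boosted ground states),
  §2.7 (`N_k = ∑ e^{ikxᵢ}`, `PΨ_k = kΨ_k`).
* [Fournais2020] S. Fournais, *Length scales for BEC in the dilute Bose gas*, arXiv:2011.00309: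
  (1.1)–(1.2) (the periodic Hamiltonian and its quadratic form, as in `PeriodicBoseGas.lean`).
-/

noncomputable section

open MeasureTheory Filter Set WithLp
open scoped ENNReal NNReal Topology ComplexConjugate

namespace Literature.MathematicalPhysics.QuantumManyBody.BoseGas

variable {M : ℕ} {L : ℝ}

/-! ### The Bloch (total-momentum) condition -/

/-- **Total momentum `k`.** An `M`-body wave function `ψ` on `(ℝ³)^M` lies in the sector of total
momentum `k ∈ ℝ³` if translating all particles simultaneously by `s` multiplies it by the character
`e^{ik·s}`: `ψ(x₁ + s, …, x_M + s) = e^{i k·s} ψ(x₁, …, x_M)` for every `s ∈ ℝ³` (for `C¹`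
functions: `Pψ = kψ` with `P = ∑ⱼ -i∇ⱼ`, see `HasTotalMomentum.sum_fderiv_apply_single`). This is
membership in the range of the spectral projection `P = k` defining `H^{L,n}(k)`.
[cite: CorneanDerezinskiZin2009, §1.1 (1.6)] -/
def HasTotalMomentum (k : Space) (ψ : Config M → ℂ) : Prop :=
  ∀ (s : Space) (X : Config M),
    ψ (fun i => X i + s) = Complex.exp (Complex.I * ↑(∑ j, k j * s j)) * ψ X

/-- Total momentum `0` means invariance under simultaneous translation of all particles.
[cite: CorneanDerezinskiZin2009, §1.1 (1.6)] -/
theorem hasTotalMomentum_zero_iff {ψ : Config M → ℂ} :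
    HasTotalMomentum 0 ψ ↔ ∀ (s : Space) (X : Config M), ψ (fun i => X i + s) = ψ X := by
  simp [HasTotalMomentum]

/-- Scalar multiples stay in the sector. [folklore] -/
theorem HasTotalMomentum.const_mul {k : Space} {ψ : Config M → ℂ} (h : HasTotalMomentum k ψ)
    (c : ℂ) : HasTotalMomentum k fun X => c * ψ X := by
  intro s X
  dsimp only
  rw [h s X]
  ring

/-- Sums stay in the sector. [folklore] -/
theorem HasTotalMomentum.add {k : Space} {ψ φ : Config M → ℂ} (hψ : HasTotalMomentum k ψ)
    (hφ : HasTotalMomentum k φ) : HasTotalMomentum k fun X => ψ X + φ X := by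
  intro s X
  dsimp only
  rw [hψ s X, hφ s X]
  ring

/-- Finite sums stay in the sector. [folklore] -/
theorem HasTotalMomentum.sum {ι : Type*} {k : Space} (t : Finset ι) {ψ : ι → Config M → ℂ}
    (h : ∀ i ∈ t, HasTotalMomentum k (ψ i)) : HasTotalMomentum k fun X => ∑ i ∈ t, ψ i X := by
  intro s X
  dsimp only
  rw [Finset.mul_sum]
  exact Finset.sum_congr rfl fun i hi => h i hi s X

/-- Momenta add under pointwise products: `P(ψφ) = (k₁ + k₂) ψφ`. [folklore] -/
theorem HasTotalMomentum.mul {k₁ k₂ : Space} {ψ φ : Config M → ℂ} (hψ : HasTotalMomentum k₁ ψ)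
    (hφ : HasTotalMomentum k₂ φ) : HasTotalMomentum (k₁ + k₂) fun X => ψ X * φ X := by
  intro s X
  dsimp only
  rw [hψ s X, hφ s X]
  have hsum : (∑ j, (k₁ + k₂) j * s j) = (∑ j, k₁ j * s j) + ∑ j, k₂ j * s j := by
    rw [← Finset.sum_add_distrib]
    exact Finset.sum_congr rfl fun j _ => by rw [PiLp.add_apply]; ring
  rw [hsum, Complex.ofReal_add, mul_add, Complex.exp_add]
  ring

/-- Complex conjugation reverses the momentum: `P conj(ψ) = -k conj(ψ)`. [folklore] -/
theorem HasTotalMomentum.conj {k : Space} {ψ : Config M → ℂ} (h : HasTotalMomentum k ψ) :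
    HasTotalMomentum (-k) fun X => conj (ψ X) := by
  intro s X
  dsimp only
  rw [h s X, map_mul, ← Complex.exp_conj, map_mul, Complex.conj_I, Complex.conj_ofReal]
  have hsum : (∑ j, (-k) j * s j) = -∑ j, k j * s j := by
    rw [← Finset.sum_neg_distrib]
    exact Finset.sum_congr rfl fun j _ => by rw [PiLp.neg_apply]; ring
  rw [hsum, Complex.ofReal_neg]
  ring_nf

/-- The plane wave `e^{2πi n·xⱼ/L}` in the `j`-th particle has total momentum `2πn/L`.
[cite: CorneanDerezinskiZin2009, §2.7] -/
theorem hasTotalMomentum_cellWave (L : ℝ) (n : Fin 3 → ℤ) (j : Fin M) :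
    HasTotalMomentum (latticeVec (2 * Real.pi / L) n) fun X : Config M => cellWave L n (X j) := by
  intro s X
  simp only [cellWave_apply]
  rw [← Complex.exp_add]
  congr 1
  have h1 : (∑ k, (n k : ℝ) * (X j + s) k) = (∑ k, (n k : ℝ) * X j k) + ∑ k, (n k : ℝ) * s k := by
    rw [← Finset.sum_add_distrib]
    exact Finset.sum_congr rfl fun k _ => by rw [PiLp.add_apply]; ring
  have h2 : (∑ k, (latticeVec (2 * Real.pi / L) n) k * s k) =
      2 * Real.pi / L * ∑ k, (n k : ℝ) * s k := by
    rw [Finset.mul_sum]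
    exact Finset.sum_congr rfl fun k _ => by simp only [latticeVec, PiLp.toLp_apply]; ring
  rw [h1, h2]
  push_cast
  ring

/-! ### The energy infimum in a momentum sector -/

/-- **The infimum of the energy–momentum spectrum in the box** at total momentum `k`:
`inf sp H^{L,M}(k) = E^{L,M} + ε^{L,M}(k)`, where `H^{L,M}(k)` is the restriction of the periodic
`M`-body Hamiltonian `H = ∑ⱼ -Δⱼ + ∑_{i<j} v^per(xᵢ - xⱼ)` on the torus of side `L` to the
subspace of total momentum `P = k` and `ε^{L,M}(k)` is the infimum of the excitation spectrum
(IES) in the box. Rendered variationally, in the units `ħ = 2m = 1` of `PeriodicBoseGas.lean`: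
the infimum of the quadratic form `periodicEnergy v Ψ` over the admissible periodic `C¹` states
`Ψ` with `HasTotalMomentum k Ψ.ψ`. It is `⊤` for an empty sector (`k ∉ (2π/L)ℤ³`, or
`L ≤ 0 < M`). [cite: CorneanDerezinskiZin2009, §1.1 (1.6)] -/
def momentumSectorEnergy (v : ℝ → ℝ≥0∞) (M : ℕ) (L : ℝ) (k : Space) : ℝ≥0∞ :=
  ⨅ (Ψ : PeriodicTrialState M L) (_ : HasTotalMomentum k Ψ.ψ), periodicEnergy v Ψ

/-- `momentumSectorEnergy` is, definitionally, the expression inlined in the items of route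
`BECSectorGap` (an `iInf` over periodic trial states subject to the Bloch condition).
[cite: CorneanDerezinskiZin2009, §1.1 (1.6)] -/
theorem momentumSectorEnergy_eq_iInf (v : ℝ → ℝ≥0∞) (M : ℕ) (L : ℝ) (k : Space) :
    momentumSectorEnergy v M L k =
      ⨅ (Ψ : PeriodicTrialState M L) (_ : ∀ (s : EuclideanSpace ℝ (Fin 3))
        (X : Fin M → EuclideanSpace ℝ (Fin 3)),
        Ψ.ψ (fun i => X i + s) = Complex.exp (Complex.I * ↑(∑ j, k j * s j)) * Ψ.ψ X),
        periodicEnergy v Ψ :=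
  rfl

/-- Variational principle in the sector: every admissible state of total momentum `k` bounds
`inf sp H(k)` from above. [cite: CorneanDerezinskiZin2009, §1.1 (1.6)] -/
theorem momentumSectorEnergy_le (v : ℝ → ℝ≥0∞) {k : Space} (Ψ : PeriodicTrialState M L)
    (h : HasTotalMomentum k Ψ.ψ) : momentumSectorEnergy v M L k ≤ periodicEnergy v Ψ :=
  iInf₂_le Ψ h

/-- Lower bounds on the sector energy are exactly the uniform lower bounds on the energies of the
states in the sector. [folklore] -/
theorem le_momentumSectorEnergy_iff {v : ℝ → ℝ≥0∞} {k : Space} {a : ℝ≥0∞} :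
    a ≤ momentumSectorEnergy v M L k ↔
      ∀ Ψ : PeriodicTrialState M L, HasTotalMomentum k Ψ.ψ → a ≤ periodicEnergy v Ψ :=
  le_iInf₂_iff

/-- `E^{L,M} ≤ inf sp H^{L,M}(k)`, i.e. `ε^{L,M}(k) ≥ 0`: the sector infimum is an infimum over a
subclass. [cite: CorneanDerezinskiZin2009, §1.1 (1.6)] -/
theorem periodicGroundStateEnergy_le_momentumSectorEnergy (v : ℝ → ℝ≥0∞) (M : ℕ) (L : ℝ)
    (k : Space) : periodicGroundStateEnergy v M L ≤ momentumSectorEnergy v M L k :=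
  le_iInf₂ fun Ψ _ => periodicGroundStateEnergy_le v Ψ

/-! ### Conjugation symmetry `k ↦ -k` -/

/-- The complex-conjugate state `conj ∘ Ψ` of an admissible periodic state (time reversal): again
admissible, with the same modulus. [folklore] -/
def PeriodicTrialState.conj (Ψ : PeriodicTrialState M L) : PeriodicTrialState M L where
  ψ X := conj (Ψ.ψ X)
  contDiff := Complex.conjCLE.contDiff.comp Ψ.contDiff
  periodic X i a := by rw [Ψ.periodic]
  symm σ X := by rw [Ψ.symm]
  norm_eq := by simp only [RCLike.nnnorm_conj, Ψ.norm_eq]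

/-- The conjugate wave function. [folklore] -/
theorem PeriodicTrialState.conj_apply (Ψ : PeriodicTrialState M L) (X : Config M) :
    Ψ.conj.ψ X = conj (Ψ.ψ X) :=
  rfl

/-- `|∇ conj(ψ)|² = |∇ψ|²` pointwise (conjugation is a real-linear isometry). [folklore] -/
theorem kineticDensity_conj (ψ : Config M → ℂ) (X : Config M) :
    kineticDensity (fun Y => conj (ψ Y)) X = kineticDensity ψ X := by
  unfold kineticDensity
  have h : (fun Y => conj (ψ Y)) = Complex.conjCLE ∘ ψ := rfl
  simp only [h, ContinuousLinearEquiv.comp_fderiv, ContinuousLinearMap.coe_comp,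
    Function.comp_apply, ContinuousLinearEquiv.coe_coe, Complex.conjCLE_apply, RCLike.nnnorm_conj]

/-- Conjugation preserves the periodic energy `⟨Ψ, HΨ⟩` (`H` is real). [folklore] -/
theorem periodicEnergy_conj (v : ℝ → ℝ≥0∞) (Ψ : PeriodicTrialState M L) :
    periodicEnergy v Ψ.conj = periodicEnergy v Ψ := by
  unfold periodicEnergy
  refine lintegral_congr fun X => ?_
  rw [show Ψ.conj.ψ = fun Y => conj (Ψ.ψ Y) from rfl, kineticDensity_conj]
  simp only [RCLike.nnnorm_conj]

/-- **Reflection symmetry of the energy–momentum spectrum**: `inf sp H(-k) = inf sp H(k)`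
(complex conjugation maps the sector `k` onto the sector `-k` isometrically and commutes with
`H`). [folklore] -/
theorem momentumSectorEnergy_neg (v : ℝ → ℝ≥0∞) (M : ℕ) (L : ℝ) (k : Space) :
    momentumSectorEnergy v M L (-k) = momentumSectorEnergy v M L k := by
  apply le_antisymm
  · exact le_iInf₂ fun Ψ hΨ =>
      (momentumSectorEnergy_le v Ψ.conj hΨ.conj).trans_eq (periodicEnergy_conj v Ψ)
  · refine le_iInf₂ fun Ψ hΨ => (momentumSectorEnergy_le v Ψ.conj ?_).trans_eq
      (periodicEnergy_conj v Ψ)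
    have h' := hΨ.conj
    rw [neg_neg] at h'
    exact h'

/-! ### The sector lives on the dual lattice `(2π/L)ℤ³` -/

/-- A normalised state does not vanish identically. [folklore] -/
theorem PeriodicTrialState.exists_ne_zero (Ψ : PeriodicTrialState M L) : ∃ X, Ψ.ψ X ≠ 0 := by
  by_contra h
  push Not at h
  have h1 := Ψ.norm_eq
  simp [h] at h1

/-- Translating *every* particle by the lattice generator `L eₐ` does not change a periodic
state. [folklore] -/
theorem PeriodicTrialState.apply_add_single (Ψ : PeriodicTrialState M L) (X : Config M)
    (a : Fin 3) : Ψ.ψ (fun i => X i + EuclideanSpace.single a L) = Ψ.ψ X := by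
  have key : ∀ S : Finset (Fin M),
      Ψ.ψ (X + ∑ i ∈ S, Pi.single i (EuclideanSpace.single a L)) = Ψ.ψ X := by
    intro S
    induction S using Finset.induction_on with
    | empty => simp
    | insert j S hj ih =>
      rw [Finset.sum_insert hj, add_comm (Pi.single j _), ← add_assoc, Ψ.periodic, ih]
  have h := key Finset.univ
  rw [Finset.univ_sum_single (fun _ : Fin M => (EuclideanSpace.single a L : Space))] at h
  exact h

/-- **The momentum spectrum in the box is `(2π/L)ℤ³`**: if an admissible periodic state on the
torus of side `L > 0` has total momentum `k`, then `k = 2πn/L` for some `n ∈ ℤ³` (translation of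
all particles by `L eₐ` is trivial by periodicity and multiplies by `e^{i kₐ L}`).
[cite: CorneanDerezinskiZin2009, §1.1 (joint spectrum of `P^{L,n}`)] -/
theorem HasTotalMomentum.exists_eq_latticeVec (hL : 0 < L) {k : Space} (Ψ : PeriodicTrialState M L)
    (h : HasTotalMomentum k Ψ.ψ) : ∃ n : Fin 3 → ℤ, k = latticeVec (2 * Real.pi / L) n := by
  obtain ⟨X, hX⟩ := Ψ.exists_ne_zero
  have hcoord : ∀ a : Fin 3, ∃ n : ℤ, k a * L = n * (2 * Real.pi) := by
    intro a
    have h1 := h (EuclideanSpace.single a L) X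
    rw [Ψ.apply_add_single] at h1
    have hsum : (∑ j, k j * (EuclideanSpace.single a L : Space) j) = k a * L := by
      simp
    rw [hsum] at h1
    have h2 : Complex.exp (Complex.I * ↑(k a * L)) = 1 :=
      mul_right_cancel₀ hX (h1.symm.trans (one_mul _).symm)
    obtain ⟨n, hn⟩ := Complex.exp_eq_one_iff.mp h2
    refine ⟨n, ?_⟩
    have hn' : ((k a * L : ℝ) : ℂ) = ((n * (2 * Real.pi) : ℝ) : ℂ) := by
      apply mul_left_cancel₀ Complex.I_ne_zero
      rw [hn]; push_cast; ring
    exact_mod_cast hn'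
  choose n hn using hcoord
  refine ⟨n, ?_⟩
  ext a
  simp only [latticeVec, PiLp.toLp_apply]
  have := hn a
  field_simp
  linarith

/-- **Empty sectors**: off the dual lattice the sector is empty and `inf sp H(k) = ⊤` (infimum
over the empty set). [cite: CorneanDerezinskiZin2009, §1.1 (1.6)] -/
theorem momentumSectorEnergy_eq_top_of_forall_ne (hL : 0 < L) (v : ℝ → ℝ≥0∞) {k : Space}
    (hk : ∀ n : Fin 3 → ℤ, k ≠ latticeVec (2 * Real.pi / L) n) :
    momentumSectorEnergy v M L k = ⊤ := by
  refine iInf_eq_top.2 fun Ψ => iInf_eq_top.2 fun hΨ => ?_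
  obtain ⟨n, hn⟩ := hΨ.exists_eq_latticeVec hL Ψ
  exact absurd hn (hk n)

/-- For `L ≤ 0` and `M ≥ 1` the fundamental cell `[0,L)^{3M}` is empty. [folklore] -/
theorem cellN_eq_empty_of_nonpos (hL : L ≤ 0) (hM : 0 < M) : cellN M L = ∅ := by
  ext X
  simp only [cellN, cell, Set.mem_setOf_eq, Set.mem_Ico, Set.mem_empty_iff_false, iff_false,
    not_forall, not_and, not_lt]
  exact ⟨⟨0, hM⟩, 0, fun h0 => hL.trans h0⟩

/-- For `L ≤ 0` and `M ≥ 1` there are no admissible periodic states (nothing is normalised on an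
empty cell). [folklore] -/
theorem PeriodicTrialState.isEmpty_of_nonpos (hL : L ≤ 0) (hM : 0 < M) :
    IsEmpty (PeriodicTrialState M L) :=
  ⟨fun Ψ => by
    have h := Ψ.norm_eq
    rw [cellN_eq_empty_of_nonpos hL hM, Measure.restrict_empty, lintegral_zero_measure] at h
    exact zero_ne_one h⟩

/-- For `L ≤ 0` and `M ≥ 1` every sector energy is `⊤`. [folklore] -/
theorem momentumSectorEnergy_of_nonpos (hL : L ≤ 0) (hM : 0 < M) (v : ℝ → ℝ≥0∞) (k : Space) :
    momentumSectorEnergy v M L k = ⊤ := by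
  haveI := PeriodicTrialState.isEmpty_of_nonpos hL hM
  exact iInf_of_empty _

/-! ### The momentum eigenvalue equation and the centre-of-mass bound -/

/-- **`PΨ = kΨ` pointwise.** For a differentiable `ψ` of total momentum `k`, the derivative along
the simultaneous translation of all particles in direction `eₐ` is `i kₐ ψ`:
`∑ⱼ ∂_{j,a} ψ(X) = i kₐ ψ(X)` (differentiate the Bloch condition at `s = 0`).
[cite: CorneanDerezinskiZin2009, §2.7 (PΨ_k = kΨ_k)] -/
theorem HasTotalMomentum.sum_fderiv_apply_single {k : Space} {ψ : Config M → ℂ}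
    (h : HasTotalMomentum k ψ) (hψ : Differentiable ℝ ψ) (X : Config M) (a : Fin 3) :
    ∑ i, fderiv ℝ ψ X (Pi.single i (EuclideanSpace.single a 1)) =
      (k a : ℂ) * Complex.I * ψ X := by
  -- the diagonal direction `D = (eₐ, …, eₐ)`
  set D : Config M := fun _ => (EuclideanSpace.single a (1 : ℝ) : Space) with hD
  have hsumD : (∑ i : Fin M, (Pi.single i (EuclideanSpace.single a (1 : ℝ) : Space) : Config M)) =
      D := Finset.univ_sum_single D
  -- derivative of `t ↦ ψ (X + tD)` at `0`, by the chain rule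
  have h1 : HasDerivAt (fun t : ℝ => ψ (X + t • D)) (fderiv ℝ ψ X D) 0 := by
    have hp : HasDerivAt (fun t : ℝ => X + t • D) D 0 := by
      simpa using ((hasDerivAt_id (0 : ℝ)).smul_const D).const_add X
    have hc : HasDerivAt (ψ ∘ fun t : ℝ => X + t • D) (fderiv ℝ ψ (X + (0 : ℝ) • D) D) 0 :=
      HasFDerivAt.comp_hasDerivAt (0 : ℝ) (hψ _).hasFDerivAt hp
    simpa [Function.comp_def] using hc
  -- the same function is `t ↦ e^{i kₐ t} ψ X`, by the Bloch condition
  have hfun : (fun t : ℝ => ψ (X + t • D)) =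
      fun t : ℝ => Complex.exp ((t : ℂ) * ((k a : ℂ) * Complex.I)) * ψ X := by
    funext t
    have ht := h (t • EuclideanSpace.single a 1) X
    have hX : (fun i => X i + t • EuclideanSpace.single a (1 : ℝ)) = X + t • D := by
      funext i; simp [hD]
    rw [hX] at ht
    rw [ht]
    congr 2
    have hs : (∑ j, k j * (t • EuclideanSpace.single a (1 : ℝ) : Space) j) = t * k a := by
      simp [mul_comm]
    rw [hs]
    push_cast
    ring
  have h2 : HasDerivAt (fun t : ℝ => ψ (X + t • D)) ((k a : ℂ) * Complex.I * ψ X) 0 := by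
    rw [hfun]
    have he : HasDerivAt (fun t : ℝ => Complex.exp ((t : ℂ) * ((k a : ℂ) * Complex.I)))
        ((k a : ℂ) * Complex.I) 0 := by
      have := ((Complex.ofRealCLM.hasDerivAt (x := (0 : ℝ))).mul_const
        ((k a : ℂ) * Complex.I)).cexp
      simpa using this
    simpa using he.mul_const (ψ X)
  rw [← h1.unique h2, ← hsumD, map_sum]

/-- **Centre-of-mass kinetic energy, pointwise**: for `ψ` of total momentum `k`,
`(|k|²/M) |ψ(X)|² ≤ |∇ψ(X)|²` (Cauchy–Schwarz `|∑ⱼ∂_{j,a}ψ|² ≤ M ∑ⱼ|∂_{j,a}ψ|²` and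
`∑ⱼ ∂_{j,a}ψ = i kₐ ψ`). For `M = 0` both sides vanish. [folklore] -/
theorem HasTotalMomentum.norm_sq_mul_le_kineticDensity {k : Space} {ψ : Config M → ℂ}
    (h : HasTotalMomentum k ψ) (hψ : Differentiable ℝ ψ) (X : Config M) :
    ENNReal.ofReal (‖k‖ ^ 2 / M) * ((‖ψ X‖₊ : ℝ≥0∞)) ^ 2 ≤ kineticDensity ψ X := by
  rcases Nat.eq_zero_or_pos M with hM | hM
  · subst hM; simp
  have hMpos : (0 : ℝ) < M := by exact_mod_cast hM
  -- one coordinate direction at a time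
  have hcoord : ∀ a : Fin 3, (k a) ^ 2 * ‖ψ X‖ ^ 2 ≤
      M * ∑ i, ‖fderiv ℝ ψ X (Pi.single i (EuclideanSpace.single a 1))‖ ^ 2 := by
    intro a
    calc (k a) ^ 2 * ‖ψ X‖ ^ 2
        = ‖∑ i, fderiv ℝ ψ X (Pi.single i (EuclideanSpace.single a 1))‖ ^ 2 := by
          rw [h.sum_fderiv_apply_single hψ X a, norm_mul, norm_mul, Complex.norm_real,
            Complex.norm_I, mul_one, mul_pow, Real.norm_eq_abs, sq_abs]
      _ ≤ (∑ i, ‖fderiv ℝ ψ X (Pi.single i (EuclideanSpace.single a 1))‖) ^ 2 := by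
          gcongr
          exact norm_sum_le _ _
      _ ≤ (Finset.univ : Finset (Fin M)).card *
            ∑ i, ‖fderiv ℝ ψ X (Pi.single i (EuclideanSpace.single a 1))‖ ^ 2 :=
          sq_sum_le_card_mul_sum_sq
      _ = M * ∑ i, ‖fderiv ℝ ψ X (Pi.single i (EuclideanSpace.single a 1))‖ ^ 2 := by
          rw [Finset.card_univ, Fintype.card_fin]
  -- sum over the three directions
  have hreal : ‖k‖ ^ 2 / M * ‖ψ X‖ ^ 2 ≤
      ∑ i, ∑ a : Fin 3, ‖fderiv ℝ ψ X (Pi.single i (EuclideanSpace.single a 1))‖ ^ 2 := by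
    rw [Finset.sum_comm, EuclideanSpace.real_norm_sq_eq, div_mul_eq_mul_div,
      div_le_iff₀ hMpos, Finset.sum_mul, Finset.sum_mul]
    refine Finset.sum_le_sum fun a _ => ?_
    rw [mul_comm _ (M : ℝ)]
    exact hcoord a
  -- transfer to `ℝ≥0∞`
  unfold kineticDensity
  simp only [coe_nnnorm_sq_eq_ofReal]
  rw [← ENNReal.ofReal_mul (by positivity)]
  calc ENNReal.ofReal (‖k‖ ^ 2 / M * ‖ψ X‖ ^ 2)
      ≤ ENNReal.ofReal (∑ i, ∑ a : Fin 3,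
          ‖fderiv ℝ ψ X (Pi.single i (EuclideanSpace.single a 1))‖ ^ 2) :=
        ENNReal.ofReal_le_ofReal hreal
    _ = ∑ i, ∑ a : Fin 3,
          ENNReal.ofReal (‖fderiv ℝ ψ X (Pi.single i (EuclideanSpace.single a 1))‖ ^ 2) := by
        rw [ENNReal.ofReal_sum_of_nonneg fun i _ => Finset.sum_nonneg fun a _ => sq_nonneg _]
        exact Finset.sum_congr rfl fun i _ => ENNReal.ofReal_sum_of_nonneg fun a _ => sq_nonneg _

/-- **Centre-of-mass bound on the energy of a state in the sector**: `⟨Ψ, HΨ⟩ ≥ |k|²/M` for every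
admissible `Ψ` of total momentum `k` (`H ≥ P²/(2mM)` with `2m = 1`; the interaction is
non-negative). [cite: CorneanDerezinskiZin2009, §2.2 (2.3)] -/
theorem HasTotalMomentum.ofReal_norm_sq_div_le_periodicEnergy (v : ℝ → ℝ≥0∞) {k : Space}
    (Ψ : PeriodicTrialState M L) (h : HasTotalMomentum k Ψ.ψ) :
    ENNReal.ofReal (‖k‖ ^ 2 / M) ≤ periodicEnergy v Ψ := by
  have hd : Differentiable ℝ Ψ.ψ := Ψ.contDiff.differentiable one_ne_zero
  calc ENNReal.ofReal (‖k‖ ^ 2 / M)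
      = ENNReal.ofReal (‖k‖ ^ 2 / M) * ∫⁻ X in cellN M L, ((‖Ψ.ψ X‖₊ : ℝ≥0∞)) ^ 2 := by
        rw [Ψ.norm_eq, mul_one]
    _ = ∫⁻ X in cellN M L, ENNReal.ofReal (‖k‖ ^ 2 / M) * ((‖Ψ.ψ X‖₊ : ℝ≥0∞)) ^ 2 :=
        (lintegral_const_mul' _ _ ENNReal.ofReal_ne_top).symm
    _ ≤ periodicEnergy v Ψ :=
        lintegral_mono fun X => (h.norm_sq_mul_le_kineticDensity hd X).trans le_self_add

/-- **`inf sp H(k) ≥ |k|²/M`** (the centre-of-mass kinetic energy of total momentum `k` carried by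
`M` particles of mass `m = ½`). [cite: CorneanDerezinskiZin2009, §2.2 (2.3)] -/
theorem ofReal_norm_sq_div_le_momentumSectorEnergy (v : ℝ → ℝ≥0∞) (M : ℕ) (L : ℝ) (k : Space) :
    ENNReal.ofReal (‖k‖ ^ 2 / M) ≤ momentumSectorEnergy v M L k :=
  le_iInf₂ fun Ψ hΨ => hΨ.ofReal_norm_sq_div_le_periodicEnergy v Ψ

/-! ### Normalisation and the non-vacuity of the dual-lattice sectors -/

/-- **Positivity of the norm on the cell.** A continuous function on `(ℝ³)^M` that does not vanish
at a point of the open cell `(0,L)^{3M}` has `∫_{[0,L)^{3M}} |Φ|² > 0`. [folklore] -/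
theorem lintegral_cellN_pos {Φ : Config M → ℂ} (hΦ : Continuous Φ) {X₀ : Config M}
    (hX₀ : ∀ i a, X₀ i a ∈ Set.Ioo 0 L) (h0 : Φ X₀ ≠ 0) :
    0 < ∫⁻ X in cellN M L, ((‖Φ X‖₊ : ℝ≥0∞)) ^ 2 := by
  set U : Set (Config M) := {X | Φ X ≠ 0} ∩ {X | ∀ i a, X i a ∈ Set.Ioo 0 L} with hU
  have hUo : IsOpen U := by
    refine (isOpen_ne_fun hΦ continuous_const).inter ?_
    have hrw : {X : Config M | ∀ i a, X i a ∈ Set.Ioo 0 L} =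
        ⋂ i, ⋂ a, (fun X : Config M => X i a) ⁻¹' Set.Ioo 0 L := by
      ext X; simp
    rw [hrw]
    exact isOpen_iInter_of_finite fun i => isOpen_iInter_of_finite fun a =>
      isOpen_Ioo.preimage (by fun_prop)
  have hUcell : U ⊆ cellN M L := fun X hX i a => Set.Ioo_subset_Ico_self (hX.2 i a)
  have hUpos : 0 < volume U := hUo.measure_pos volume ⟨X₀, h0, hX₀⟩
  have hmeas : Measurable fun X => ((‖Φ X‖₊ : ℝ≥0∞)) ^ 2 :=
    (hΦ.measurable.nnnorm.coe_nnreal_ennreal).pow_const _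
  rw [pos_iff_ne_zero]
  intro hint
  have hae := (lintegral_eq_zero_iff hmeas).1 hint
  rw [Filter.EventuallyEq, ae_iff] at hae
  have hU0 : volume.restrict (cellN M L) U = 0 :=
    measure_mono_null (fun X hX => by simpa using hX.1) hae
  rw [Measure.restrict_apply hUo.measurableSet, Set.inter_eq_left.mpr hUcell] at hU0
  exact hUpos.ne' hU0

/-- **Normalising constructor.** A `C¹`, `Lℤ³`-periodic, Bose-symmetric `ψ` with
`0 < ∫_{cell} |ψ|² < ∞` yields the admissible periodic state `ψ / ‖ψ‖`. [folklore] -/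
def PeriodicTrialState.ofFun (ψ : Config M → ℂ) (hC : ContDiff ℝ 1 ψ)
    (hper : ∀ (X : Config M) (i : Fin M) (a : Fin 3),
      ψ (X + Pi.single i (EuclideanSpace.single a L)) = ψ X)
    (hsymm : ∀ (σ : Equiv.Perm (Fin M)) (X : Config M), ψ (X ∘ σ) = ψ X)
    (h0 : ∫⁻ X in cellN M L, ((‖ψ X‖₊ : ℝ≥0∞)) ^ 2 ≠ 0)
    (htop : ∫⁻ X in cellN M L, ((‖ψ X‖₊ : ℝ≥0∞)) ^ 2 ≠ ⊤) : PeriodicTrialState M L where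
  ψ X := ((Real.sqrt (∫⁻ X in cellN M L, ((‖ψ X‖₊ : ℝ≥0∞)) ^ 2).toReal)⁻¹ : ℂ) * ψ X
  contDiff := contDiff_const.mul hC
  periodic X i a := by rw [hper]
  symm σ X := by rw [hsymm]
  norm_eq := by
    set I := ∫⁻ X in cellN M L, ((‖ψ X‖₊ : ℝ≥0∞)) ^ 2 with hI
    have hIpos : 0 < I.toReal := ENNReal.toReal_pos h0 htop
    have hc : ∀ X, ((‖((Real.sqrt I.toReal)⁻¹ : ℂ) * ψ X‖₊ : ℝ≥0∞)) ^ 2 =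
        ENNReal.ofReal (I.toReal⁻¹) * ((‖ψ X‖₊ : ℝ≥0∞)) ^ 2 := by
      intro X
      rw [nnnorm_mul, ENNReal.coe_mul, mul_pow]
      congr 1
      rw [coe_nnnorm_sq_eq_ofReal, norm_inv, Complex.norm_real,
        Real.norm_of_nonneg (Real.sqrt_nonneg _), inv_pow, Real.sq_sqrt hIpos.le]
    simp_rw [hc]
    rw [lintegral_const_mul' _ _ ENNReal.ofReal_ne_top, ← hI, ENNReal.ofReal_inv_of_pos hIpos,
      ENNReal.ofReal_toReal htop, ENNReal.inv_mul_cancel h0 htop]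

/-- The normalised function is a constant multiple of `ψ`. [folklore] -/
theorem PeriodicTrialState.ofFun_apply (ψ : Config M → ℂ) (hC : ContDiff ℝ 1 ψ)
    (hper : ∀ (X : Config M) (i : Fin M) (a : Fin 3),
      ψ (X + Pi.single i (EuclideanSpace.single a L)) = ψ X)
    (hsymm : ∀ (σ : Equiv.Perm (Fin M)) (X : Config M), ψ (X ∘ σ) = ψ X)
    (h0 : ∫⁻ X in cellN M L, ((‖ψ X‖₊ : ℝ≥0∞)) ^ 2 ≠ 0)
    (htop : ∫⁻ X in cellN M L, ((‖ψ X‖₊ : ℝ≥0∞)) ^ 2 ≠ ⊤) (X : Config M) :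
    (PeriodicTrialState.ofFun ψ hC hper hsymm h0 htop).ψ X =
      ((Real.sqrt (∫⁻ X in cellN M L, ((‖ψ X‖₊ : ℝ≥0∞)) ^ 2).toReal)⁻¹ : ℂ) * ψ X :=
  rfl

/-- Normalisation does not change the momentum sector. [folklore] -/
theorem HasTotalMomentum.ofFun {k : Space} {ψ : Config M → ℂ} (h : HasTotalMomentum k ψ)
    (hC : ContDiff ℝ 1 ψ)
    (hper : ∀ (X : Config M) (i : Fin M) (a : Fin 3),
      ψ (X + Pi.single i (EuclideanSpace.single a L)) = ψ X)
    (hsymm : ∀ (σ : Equiv.Perm (Fin M)) (X : Config M), ψ (X ∘ σ) = ψ X)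
    (h0 : ∫⁻ X in cellN M L, ((‖ψ X‖₊ : ℝ≥0∞)) ^ 2 ≠ 0)
    (htop : ∫⁻ X in cellN M L, ((‖ψ X‖₊ : ℝ≥0∞)) ^ 2 ≠ ⊤) :
    HasTotalMomentum k (PeriodicTrialState.ofFun ψ hC hper hsymm h0 htop).ψ :=
  h.const_mul _

/-- **The symmetrised plane wave** `N_k 1 = ∑ⱼ e^{ik·xⱼ}`, `k = 2πn/L` (the Bijls–Feynman operator
`N_k = ∑ⱼ e^{ikxⱼ}` applied to the constant function): smooth, periodic, Bose-symmetric, of total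
momentum `k`. [cite: CorneanDerezinskiZin2009, §2.7] -/
def planeWaveSum (L : ℝ) (n : Fin 3 → ℤ) (X : Config M) : ℂ :=
  ∑ j, cellWave L n (X j)

/-- `N_k 1` is `C¹`. [folklore] -/
theorem contDiff_planeWaveSum (L : ℝ) (n : Fin 3 → ℤ) :
    ContDiff ℝ 1 (planeWaveSum (M := M) L n) :=
  ContDiff.sum fun j _ =>
    ((contDiff_cellWave L n).of_le (mod_cast le_top)).comp (contDiff_apply ℝ Space j)

/-- `N_k 1` is `Lℤ³`-periodic in every particle. [folklore] -/
theorem planeWaveSum_periodic (hL : L ≠ 0) (n : Fin 3 → ℤ) (X : Config M) (i : Fin M)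
    (a : Fin 3) :
    planeWaveSum L n (X + Pi.single i (EuclideanSpace.single a L)) = planeWaveSum L n X := by
  unfold planeWaveSum
  refine Finset.sum_congr rfl fun j _ => ?_
  rw [Pi.add_apply]
  by_cases hj : j = i
  · subst hj
    rw [Pi.single_eq_same, cellWave_periodic hL]
  · rw [Pi.single_eq_of_ne hj, add_zero]

/-- `N_k 1` is Bose-symmetric. [folklore] -/
theorem planeWaveSum_symm (L : ℝ) (n : Fin 3 → ℤ) (σ : Equiv.Perm (Fin M)) (X : Config M) :
    planeWaveSum L n (X ∘ σ) = planeWaveSum L n X := by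
  unfold planeWaveSum
  simp only [Function.comp_apply]
  exact Equiv.sum_comp σ (fun j => cellWave L n (X j))

/-- `N_k 1` has total momentum `k = 2πn/L`. [cite: CorneanDerezinskiZin2009, §2.7] -/
theorem hasTotalMomentum_planeWaveSum (L : ℝ) (n : Fin 3 → ℤ) :
    HasTotalMomentum (latticeVec (2 * Real.pi / L) n) (planeWaveSum (M := M) L n) :=
  HasTotalMomentum.sum Finset.univ fun j _ => hasTotalMomentum_cellWave L n j

/-- `|N_k 1| ≤ M`. [folklore] -/
theorem norm_planeWaveSum_le (L : ℝ) (n : Fin 3 → ℤ) (X : Config M) :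
    ‖planeWaveSum L n X‖ ≤ M := by
  unfold planeWaveSum
  refine (norm_sum_le _ _).trans ?_
  simp [norm_cellWave]

/-- On the diagonal `N_k 1 (x, …, x) = M e^{ik·x}`, of modulus `M`. [folklore] -/
theorem norm_planeWaveSum_const (L : ℝ) (n : Fin 3 → ℤ) (x : Space) :
    ‖planeWaveSum (M := M) L n (fun _ => x)‖ = M := by
  unfold planeWaveSum
  rw [Finset.sum_const, Finset.card_univ, Fintype.card_fin, nsmul_eq_mul, norm_mul,
    norm_cellWave, mul_one]
  simp

/-- `∫_{cell} |N_k 1|² < ∞`. [folklore] -/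
theorem lintegral_planeWaveSum_ne_top (L : ℝ) (n : Fin 3 → ℤ) :
    ∫⁻ X in cellN M L, ((‖planeWaveSum L n X‖₊ : ℝ≥0∞)) ^ 2 ≠ ⊤ := by
  refine ne_top_of_le_ne_top (b := ∫⁻ _ in cellN M L, (M : ℝ≥0∞) ^ 2) ?_ ?_
  · rw [setLIntegral_const, volume_cellN]
    exact ENNReal.mul_ne_top (ENNReal.pow_ne_top (ENNReal.natCast_ne_top M))
      (ENNReal.pow_ne_top (ENNReal.pow_ne_top ENNReal.ofReal_ne_top))
  · refine lintegral_mono fun X => ?_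
    gcongr
    rw [← ENNReal.coe_natCast, ENNReal.coe_le_coe, ← NNReal.coe_le_coe, coe_nnnorm,
      NNReal.coe_natCast]
    exact norm_planeWaveSum_le L n X

/-- `∫_{cell} |N_k 1|² > 0` for `L > 0`, `M ≥ 1`. [folklore] -/
theorem lintegral_planeWaveSum_ne_zero (hL : 0 < L) (hM : 0 < M) (n : Fin 3 → ℤ) :
    ∫⁻ X in cellN M L, ((‖planeWaveSum L n X‖₊ : ℝ≥0∞)) ^ 2 ≠ 0 := by
  set c : Space := toLp 2 fun _ => L / 2 with hc
  refine (lintegral_cellN_pos (X₀ := fun _ => c) (contDiff_planeWaveSum L n).continuous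
    (fun i a => ?_) ?_).ne'
  · simp only [hc, PiLp.toLp_apply, Set.mem_Ioo]
    constructor <;> linarith
  · rw [← norm_ne_zero_iff, norm_planeWaveSum_const]
    exact_mod_cast hM.ne'

/-- **The normalised symmetrised plane wave** `N_k 1/‖N_k 1‖` of momentum `k = 2πn/L` on the torus
of side `L > 0`, `M ≥ 1` particles: an admissible periodic state in the sector `k`.
[cite: CorneanDerezinskiZin2009, §2.7] -/
def PeriodicTrialState.planeWave (hL : 0 < L) (hM : 0 < M) (n : Fin 3 → ℤ) :
    PeriodicTrialState M L :=
  PeriodicTrialState.ofFun (planeWaveSum L n) (contDiff_planeWaveSum L n)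
    (planeWaveSum_periodic hL.ne' n) (planeWaveSum_symm L n)
    (lintegral_planeWaveSum_ne_zero hL hM n) (lintegral_planeWaveSum_ne_top L n)

/-- The normalised plane wave has total momentum `2πn/L`. [cite: CorneanDerezinskiZin2009, §2.7] -/
theorem PeriodicTrialState.hasTotalMomentum_planeWave (hL : 0 < L) (hM : 0 < M)
    (n : Fin 3 → ℤ) :
    HasTotalMomentum (latticeVec (2 * Real.pi / L) n) (PeriodicTrialState.planeWave hL hM n).ψ :=
  (hasTotalMomentum_planeWaveSum L n).ofFun _ _ _ _ _

/-- **Non-vacuity of the dual-lattice sectors**: for `L > 0`, `M ≥ 1` and `n ∈ ℤ³` the sector of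
total momentum `2πn/L` contains an admissible state, so `momentumSectorEnergy v M L (2πn/L)` is
not an infimum over the empty set. [cite: CorneanDerezinskiZin2009, §1.1 (joint spectrum of `P^{L,n}`)] -/
theorem exists_hasTotalMomentum (hL : 0 < L) (hM : 0 < M) (n : Fin 3 → ℤ) :
    ∃ Ψ : PeriodicTrialState M L, HasTotalMomentum (latticeVec (2 * Real.pi / L) n) Ψ.ψ :=
  ⟨_, PeriodicTrialState.hasTotalMomentum_planeWave hL hM n⟩

/-- **The momentum spectrum in the box is exactly `(2π/L)ℤ³`** (`L > 0`, `M ≥ 1`): the sector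
`k` is inhabited by an admissible periodic state iff `k ∈ (2π/L)ℤ³`.
[cite: CorneanDerezinskiZin2009, §1.1 (joint spectrum of `P^{L,n}`)] -/
theorem exists_hasTotalMomentum_iff (hL : 0 < L) (hM : 0 < M) (k : Space) :
    (∃ Ψ : PeriodicTrialState M L, HasTotalMomentum k Ψ.ψ) ↔
      ∃ n : Fin 3 → ℤ, k = latticeVec (2 * Real.pi / L) n := by
  constructor
  · rintro ⟨Ψ, hΨ⟩
    exact hΨ.exists_eq_latticeVec hL Ψ
  · rintro ⟨n, rfl⟩
    exact exists_hasTotalMomentum hL hM n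

/-- In an inhabited sector the sector energy is bounded by the energy of the plane wave; in
particular `momentumSectorEnergy v M L (2πn/L) ≤ periodicEnergy v (planeWave hL hM n)`.
[folklore] -/
theorem momentumSectorEnergy_latticeVec_le_planeWave (v : ℝ → ℝ≥0∞) (hL : 0 < L) (hM : 0 < M)
    (n : Fin 3 → ℤ) :
    momentumSectorEnergy v M L (latticeVec (2 * Real.pi / L) n) ≤
      periodicEnergy v (PeriodicTrialState.planeWave hL hM n) :=
  momentumSectorEnergy_le v _ (PeriodicTrialState.hasTotalMomentum_planeWave hL hM n)

end Literature.MathematicalPhysics.QuantumManyBody.BoseGas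

end
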